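import Literature.Analysis.FluidPDE.TorusNSFoiasGuillopeTemam
import Literature.Analysis.FluidPDE.TorusPalinstrophyRate
import HarnessLib

/-!
# The `H³` rung of the Foias–Guillopé–Temam ladder on `T³` with explicit constants:
# `∫₀ᵀ ‖∇Δu‖₂² /(1 + ‖Δu‖₂²)^{4/3} dt`, `∫₀ᵀ ‖∇Δu‖₂^{2/5} dt` and `∫₀ᵀ ‖∇u‖_∞^{1/2} dt`

Analysis/FluidPDE proof file (theorems only; no definitions, no named facts).

Search for candidate a priori estimates; no regularity claim. Sequel of
`TorusNSFoiasGuillopeTemam.lean` (the rung `H¹ → H²`: `∫₀ᵀ ‖Δu‖₂²/(1+‖∇u‖₂²)² ≤ Y₁`,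
`∫₀ᵀ ‖Δu‖₂^{2/3} ≤ Y₁^{1/3}(T + E)^{2/3}`, `E = ‖u(0)‖₂²/(2ν)`, `Y₁ = 1/ν + 27‖u(0)‖₂²/(8π⁴ν⁵)`).
Foias, Guillopé & Temam (1981, Thm 3.1) prove for weak solutions on `T³` that
`∫₀ᵀ ‖u‖_{H^m}^{2/(2m−1)} dt < ∞` for every `m ≥ 1`, and in particular (`m` large + Agmon)
`∫₀ᵀ ‖∇u‖_∞^{1/2} dt < ∞`; in Gibbon's chessboard (J. Nonlinear Sci. 29 (2019), Thm 1, Table 1)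
these are the squares `(n, m) = (3, 1)` (`α_{3,1} = 2/5`) and `(1, ∞)` (`α_{1,∞} = 1/2`). Here the
rung `m = 3` is PROVED for classical solutions with mean-zero slices on `[0, T] × T^d`,
`card d = 3`, with every constant explicit, from the tree's `H²` rate law
`½ d/dt‖Δu‖₂² ≤ −ν‖∇Δu‖₂² + (3√2/π)‖Δu‖₂^{5/2}‖∇Δu‖₂^{1/2}`
(`Torus.IsClassicalNSSolutionOn.halfLaplacianSqRate_le_rpow`, Doering–Gibbon rung `N = 2` with
`c₂ = 3` and the gradient Agmon inequality `‖∇u‖²_{∞,F} ≤ (2/π²)‖Δu‖₂‖∇Δu‖₂`):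

* `Torus.classicalNS_integral_gradNormSq_laplacian_div_le` — **the weighted `H³` dissipation
  bound** `ν ∫₀ᵀ ‖∇Δu‖₂²/(1 + ‖Δu‖₂²)^{4/3} dt ≤ 3 + K₃(ν) Y₁^{1/3}(T + E)^{2/3}`,
  `K₃(ν) = (3/2)(3√2/π)^{4/3}(2ν)^{−1/3}` (monotone quantity `3(1 + ‖Δu‖₂²)^{−1/3}`, Young with
  weights `3/4, 1/4`, and the `H²` rung `∫₀ᵀ‖Δu‖₂^{2/3}`);
* `Torus.classicalNS_integral_gradNormSq_laplacian_fifth_le` — **the square `(3, 1)`**: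
  `∫₀ᵀ ‖∇Δu‖₂^{2/5} dt ≤ ((3 + K₃Y₁^{1/3}(T+E)^{2/3})/ν)^{1/5} (T + Y₁^{1/3}(T+E)^{2/3})^{4/5}`
  (Hölder `5, 5/4` in time);
* `Torus.classicalNS_integral_gradientAgmonMajorant_le` — **the square `(1, ∞)`**: with the
  explicit pointwise majorant `∑ᵢ‖∂ᵢu(t,x)‖² ≤ A(t)² := (2/π²)‖Δu(t)‖₂‖∇Δu(t)‖₂`
  (`Torus.sum_norm_sq_partialDeriv_le_agmon_explicit`),
  `∫₀ᵀ A(t)^{1/2} dt ≤ (2/π²)^{1/4} ((3 + K₃Y₁^{1/3}(T+E)^{2/3})/ν)^{1/8} (T + Y₁^{1/3}(T+E)^{2/3})^{7/8}`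
  (Hölder `8, 8/7`), i.e. `∫₀ᵀ ‖∇u‖_{∞,F}^{1/2} dt` — and, since `|ω|² ≤ 2∑ᵢ‖∂ᵢu‖²`,
  `∫₀ᵀ ‖ω‖_∞^{1/2} dt` — is bounded a priori by the data (contrast: the Beale–Kato–Majda
  continuation criterion needs `∫₀ᵀ ‖ω‖_∞ dt`, exponent `1 = 2 · α_{1,∞}`).

Scope (faithfulness): FGT state Thm 3.1 for Leray–Hopf weak solutions on `T³` (via Galerkin
approximation); here classical solutions with mean-zero slices on `[0, T]`, unforced, the bounds
written out in `ν, T, ‖u(0)‖₂`; only the rung `m = 3` (higher rungs need the `H^m` balances for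
`m ≥ 3`, i.e. the Doering–Gibbon ladder for `N ≥ 3`, not in the tree). `‖∇u‖_∞` enters through
its explicit Agmon majorant (Frobenius normalisation), as in `TorusNSFoiasGuillopeTemam`.

## Mathlib / tree search

Tree (used): `Torus.IsClassicalNSSolutionOn.halfLaplacianSqRate_le_rpow` (`TorusPalinstrophyRate`),
`Torus.sum_norm_sq_partialDeriv_le_agmon_explicit` (`TorusPalinstrophyLadder`),
`Torus.IsClassicalNSSolutionOn.hasDerivWithinAt_half_integral_norm_laplacian_sq`
(`TorusClassicalNSH2Smoothing`), `Torus.classicalNS_integral_laplacian_twoThirds_le`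
(`TorusNSFoiasGuillopeTemam`), `Torus.eventually_norm_sub_lt_of_continuousOn` (tube lemma);
Mathlib `intervalIntegral.integral_le_sub_of_hasDeriv_right_of_le`, `HasDerivWithinAt.rpow_const`,
`Real.geom_mean_le_arith_mean2_weighted`, `integral_mul_le_Lp_mul_Lq_of_nonneg`,
`Real.rpow_add_le_add_rpow`. Searched: `gradNormSq.*laplacian.*div|H3|fifth` — nothing.

## References

* [FoiasGuillopeTemam1981] C. Foias, C. Guillopé, R. Temam, *New a priori estimates for
  Navier–Stokes equations in dimension 3*, Comm. PDE 6 (1981) 329–359, Thm 3.1.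
* [Gibbon2019Chessboard] J. D. Gibbon, J. Nonlinear Sci. 29 (2019) 215–228, Thm 1 and Table 1
  (squares `(3,1)`, `(1,∞)`); Appendix A (A.1).
* [DoeringGibbon1995] Ch. 6, Thm 6.1 (the ladder), used through the tree files above.
-/

noncomputable section

open Set MeasureTheory intervalIntegral Filter Real
open scoped InnerProductSpace RealInnerProductSpace Topology ENNReal

namespace Literature.Analysis.FluidPDE

open Literature.Analysis.FunctionSpaces

variable {d : Type*} [Fintype d] [DecidableEq d]

/-! ### Continuity in time of `‖Δu‖₂²` and `‖∇Δu‖₂²` -/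

omit [DecidableEq d] in
/-- Space integrals of fields with continuous space–time lift and continuous slices depend
continuously on time (tube lemma over the compact torus). [folklore] -/
private theorem continuousOn_integral_of_continuousOn_stLift' {S : Set ℝ}
    {φ : ℝ → UnitAddTorus d → ℝ} (hφ : ContinuousOn (Torus.stLift φ) (S ×ˢ univ))
    (hsl : ∀ t ∈ S, Continuous (φ t)) : ContinuousOn (fun t => ∫ x, φ t x) S := by
  intro t ht
  rw [ContinuousWithinAt, Metric.tendsto_nhds]
  intro ε hε
  have h := Torus.eventually_norm_sub_lt_of_continuousOn hφ ht (half_pos hε)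
  filter_upwards [h, self_mem_nhdsWithin] with s hs hsS
  have his : Integrable (φ s) := (hsl s hsS).integrable_unitAddTorus
  have hit : Integrable (φ t) := (hsl t ht).integrable_unitAddTorus
  rw [Real.dist_eq, ← integral_sub his hit]
  calc |∫ x, (φ s x - φ t x)| ≤ ∫ x, |φ s x - φ t x| := abs_integral_le_integral_abs
    _ ≤ ∫ _x : UnitAddTorus d, ε / 2 := by
        refine integral_mono_of_nonneg (ae_of_all _ fun x => abs_nonneg _) (integrable_const _)
          (ae_of_all _ fun x => ?_)
        have h1 := hs x
        rw [Real.norm_eq_abs] at h1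
        exact h1.le
    _ = ε / 2 := by simp
    _ < ε := half_lt_self hε

/-- Along a classical solution on `[a, b]`, `t ↦ ‖∇Δu(t)‖₂² = Torus.gradNormSq (Δu(t))` is
continuous on `[a, b]` (joint smoothness of `∂ᵢΔu`, tube lemma). [folklore] -/
private theorem continuousOn_gradNormSq_laplacian {ν a b : ℝ} (hab : a < b)
    {f u : ℝ → UnitAddTorus d → EuclideanSpace ℝ d} {p : ℝ → UnitAddTorus d → ℝ}
    (h : Torus.IsClassicalNSSolutionOn (Icc a b) ν f u p) :
    ContinuousOn (fun t => Torus.gradNormSq (Torus.laplacian (u t))) (Icc a b) := by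
  have hU : UniqueDiffOn ℝ (Icc a b) := uniqueDiffOn_Icc hab
  have hΔ := h.smooth_velocity.laplacian hU
  have hst : ∀ i, ContinuousOn
      (Torus.stLift fun t => Torus.partialDeriv i (Torus.laplacian (u t))) (Icc a b ×ˢ univ) :=
    fun i => (hΔ.partialDeriv hU i).continuousOn_stLift
  unfold Torus.gradNormSq
  refine continuousOn_integral_of_continuousOn_stLift' ?_ fun t ht => ?_
  · have e : Torus.stLift (fun t x => ∑ i, ‖Torus.partialDeriv i (Torus.laplacian (u t)) x‖ ^ 2) =
        fun q => ∑ i, ‖Torus.stLift (fun t => Torus.partialDeriv i (Torus.laplacian (u t))) q‖ ^ 2 :=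
      rfl
    rw [e]
    exact continuousOn_finsetSum _ fun i _ => ((hst i).norm).pow 2
  · have hut : Torus.IsSmooth (u t) := h.smooth_velocity.isSmooth_slice ht
    exact continuous_finsetSum _ fun i _ =>
      (((hut.laplacian.partialDeriv i).continuous).norm).pow 2

/-- Continuity of `t ↦ ‖Δu(t)‖₂²` on `[a, b]` along a classical solution (`H²` balance). [folklore] -/
private theorem continuousOn_laplacianSq {ν a b : ℝ} (hab : a < b)
    {f u : ℝ → UnitAddTorus d → EuclideanSpace ℝ d} {p : ℝ → UnitAddTorus d → ℝ}
    (h : Torus.IsClassicalNSSolutionOn (Icc a b) ν f u p) :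
    ContinuousOn (fun t => ∫ x, ‖Torus.laplacian (u t) x‖ ^ 2) (Icc a b) := by
  intro t ht
  have h1 : ContinuousWithinAt
      (fun s => (2 : ℝ) * (2⁻¹ * ∫ x, ‖Torus.laplacian (u s) x‖ ^ 2)) (Icc a b) t :=
    continuousWithinAt_const.mul
      (h.hasDerivWithinAt_half_integral_norm_laplacian_sq hab ht).continuousWithinAt
  refine h1.congr (fun s _ => ?_) ?_ <;> ring

/-! ### Young's inequality with weights `3/4, 1/4` -/

omit [Fintype d] [DecidableEq d] in
/-- `c P^{5/4} D^{1/4} ≤ (ν/2) D + (3/4) c^{4/3} (2ν)^{−1/3} P^{5/3}` for `ν > 0`, `c, P, D ≥ 0`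
(`X^{3/4}Y^{1/4} ≤ ¾X + ¼Y` with `X = c^{4/3}(2ν)^{−1/3}P^{5/3}`, `Y = 2νD`). [folklore] -/
private theorem fgt_young_three_quarters {ν c P D : ℝ} (hν : 0 < ν) (hc : 0 ≤ c) (hP : 0 ≤ P)
    (hD : 0 ≤ D) :
    c * P ^ ((5 : ℝ) / 4) * D ^ ((1 : ℝ) / 4) ≤
      ν / 2 * D + 3 / 4 * c ^ ((4 : ℝ) / 3) * (2 * ν) ^ (-(1 : ℝ) / 3) * P ^ ((5 : ℝ) / 3) := by
  have h2ν : 0 < 2 * ν := by positivity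
  set X : ℝ := c ^ ((4 : ℝ) / 3) * (2 * ν) ^ (-(1 : ℝ) / 3) * P ^ ((5 : ℝ) / 3) with hX
  set Y : ℝ := 2 * ν * D with hY
  have hX0 : 0 ≤ X := by positivity
  have hY0 : 0 ≤ Y := by positivity
  have h := Real.geom_mean_le_arith_mean2_weighted (w₁ := 3 / 4) (w₂ := 1 / 4) (by norm_num)
    (by norm_num) hX0 hY0 (by norm_num)
  have hX34 : X ^ ((3 : ℝ) / 4) = c * (2 * ν) ^ (-(1 : ℝ) / 4) * P ^ ((5 : ℝ) / 4) := by
    rw [hX, Real.mul_rpow (by positivity) (Real.rpow_nonneg hP _),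
      Real.mul_rpow (Real.rpow_nonneg hc _) (Real.rpow_nonneg h2ν.le _), ← Real.rpow_mul hc,
      ← Real.rpow_mul h2ν.le, ← Real.rpow_mul hP]
    norm_num
  have hY14 : Y ^ ((1 : ℝ) / 4) = (2 * ν) ^ ((1 : ℝ) / 4) * D ^ ((1 : ℝ) / 4) := by
    rw [hY, Real.mul_rpow h2ν.le hD]
  have hνν : (2 * ν) ^ (-(1 : ℝ) / 4) * (2 * ν) ^ ((1 : ℝ) / 4) = 1 := by
    rw [← Real.rpow_add h2ν]
    norm_num
  have hprod : X ^ ((3 : ℝ) / 4) * Y ^ ((1 : ℝ) / 4) = c * P ^ ((5 : ℝ) / 4) * D ^ ((1 : ℝ) / 4) := by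
    rw [hX34, hY14]
    calc c * (2 * ν) ^ (-(1 : ℝ) / 4) * P ^ ((5 : ℝ) / 4) * ((2 * ν) ^ ((1 : ℝ) / 4) * D ^ ((1 : ℝ) / 4))
        = c * P ^ ((5 : ℝ) / 4) * D ^ ((1 : ℝ) / 4) *
            ((2 * ν) ^ (-(1 : ℝ) / 4) * (2 * ν) ^ ((1 : ℝ) / 4)) := by ring
      _ = c * P ^ ((5 : ℝ) / 4) * D ^ ((1 : ℝ) / 4) := by rw [hνν, mul_one]
  rw [hprod] at h
  have e : 3 / 4 * X + 1 / 4 * Y =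
      ν / 2 * D + 3 / 4 * c ^ ((4 : ℝ) / 3) * (2 * ν) ^ (-(1 : ℝ) / 3) * P ^ ((5 : ℝ) / 3) := by
    rw [hX, hY]; ring
  linarith [e]

/-! ### The weighted `H³` dissipation bound -/

/-- **Weighted `H³` dissipation bound, explicit constants** (the rung `H² → H³` of the
Foias–Guillopé–Temam ladder, classical solutions on `T³`): along a classical solution of the
unforced Navier–Stokes equations with `ν > 0` on `[0, T] × T^d`, `card d = 3`, `T > 0`, with
mean-zero velocity slices,
`ν ∫₀ᵀ ‖∇Δu‖₂² /(1 + ‖Δu‖₂²)^{4/3} dt ≤ 3 + (3/2)(3√2/π)^{4/3}(2ν)^{−1/3} · Y₁^{1/3}(T + E)^{2/3}`,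
`E = ‖u(0)‖₂²/(2ν)`, `Y₁ = 1/ν + 27‖u(0)‖₂²/(8π⁴ν⁵)` (`‖∇Δu‖₂² = Torus.gradNormSq (Δu)`). Proof:
`g = 3(1 + ‖Δu‖₂²)^{−1/3}` has `g' = −(d/dt‖Δu‖₂²)(1+‖Δu‖₂²)^{−4/3} ≥ ν‖∇Δu‖₂²/(1+‖Δu‖₂²)^{4/3}
− (3/2)(3√2/π)^{4/3}(2ν)^{−1/3}‖Δu‖₂^{2/3}` by the `H²` rate law and Young (weights `3/4, 1/4`);
integrate (`0 ≤ g ≤ 3`) and use `∫₀ᵀ‖Δu‖₂^{2/3} ≤ Y₁^{1/3}(T+E)^{2/3}`.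
[cite: FoiasGuillopeTemam1981, Thm 3.1 (m = 3 rung)] [cite: Gibbon2019Chessboard, Appendix A (A.1)] -/
theorem Torus.classicalNS_integral_gradNormSq_laplacian_div_le (hd : Fintype.card d = 3) {ν T : ℝ}
    (hν : 0 < ν) (hT : 0 < T) {u : ℝ → UnitAddTorus d → EuclideanSpace ℝ d}
    {p : ℝ → UnitAddTorus d → ℝ} (h : Torus.IsClassicalNSSolutionOn (Icc 0 T) ν 0 u p)
    (hmean : ∀ t ∈ Icc 0 T, Torus.HasZeroMean (u t)) :
    ν * ∫ t in (0 : ℝ)..T, Torus.gradNormSq (Torus.laplacian (u t)) /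
        (1 + ∫ x, ‖Torus.laplacian (u t) x‖ ^ 2) ^ ((4 : ℝ) / 3) ≤
      3 + 3 / 2 * (3 * Real.sqrt 2 / π) ^ ((4 : ℝ) / 3) * (2 * ν) ^ (-(1 : ℝ) / 3) *
        ((1 / ν + 27 * (∫ x, ‖u 0 x‖ ^ 2) / (8 * π ^ 4 * ν ^ 5)) ^ ((1 : ℝ) / 3) *
          (T + (∫ x, ‖u 0 x‖ ^ 2) / (2 * ν)) ^ ((2 : ℝ) / 3)) := by
  have hπ : 0 < π := Real.pi_pos
  have h2ν : 0 < 2 * ν := by positivity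
  set c : ℝ := 3 * Real.sqrt 2 / π with hc
  have hc0 : 0 ≤ c := by positivity
  set κ : ℝ := 3 / 4 * c ^ ((4 : ℝ) / 3) * (2 * ν) ^ (-(1 : ℝ) / 3) with hκ
  have hκ0 : 0 ≤ κ := by positivity
  set P : ℝ → ℝ := fun s => ∫ x, ‖Torus.laplacian (u s) x‖ ^ 2 with hPdef
  set D : ℝ → ℝ := fun s => Torus.gradNormSq (Torus.laplacian (u s)) with hDdef
  have hP0 : ∀ s, 0 ≤ P s := fun s => integral_nonneg fun x => sq_nonneg _
  have hD0 : ∀ s, 0 ≤ D s := fun s => Torus.gradNormSq_nonneg _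
  have h1P : ∀ s, 0 < 1 + P s := fun s => by have := hP0 s; positivity
  -- the `H²` balance and its rate law
  set Ef : ℝ → ℝ := fun t => -ν * Torus.gradNormSq (Torus.laplacian (u t)) -
    ∫ x, ⟪Torus.convect (u t) (u t) x - (0 : ℝ → UnitAddTorus d → EuclideanSpace ℝ d) t x,
      Torus.laplacian (Torus.laplacian (u t)) x⟫ with hEf
  have hPd : ∀ t ∈ Icc 0 T, HasDerivWithinAt (fun s => 2⁻¹ * P s) (Ef t) (Icc 0 T) t :=
    fun t ht => h.hasDerivWithinAt_half_integral_norm_laplacian_sq hT ht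
  have hrate : ∀ t ∈ Icc 0 T, Ef t ≤ -(ν / 2) * D t + κ * P t ^ ((5 : ℝ) / 3) := by
    intro t ht
    have h1 : Ef t ≤ -ν * D t + c * P t ^ ((5 : ℝ) / 4) * D t ^ ((1 : ℝ) / 4) := by
      have := h.halfLaplacianSqRate_le_rpow hd hT ht (hPd t ht)
      simpa [hc, mul_assoc] using this
    have h2 := fgt_young_three_quarters hν hc0 (hP0 t) (hD0 t)
    rw [← hκ] at h2
    linarith
  -- the monotone quantity `g = 3 (1 + P)^{-1/3}`
  set g : ℝ → ℝ := fun s => 3 * (1 + P s) ^ (-(1 : ℝ) / 3) with hg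
  have hPd' : ∀ t ∈ Icc 0 T, HasDerivWithinAt (fun s => 1 + P s) (2 * Ef t) (Icc 0 T) t := by
    intro t ht
    have h1 := ((hPd t ht).const_mul (2 : ℝ)).const_add 1
    exact h1.congr_of_mem (fun s _ => by ring) ht
  have hgd : ∀ t ∈ Icc 0 T, HasDerivWithinAt g
      (3 * (2 * Ef t * (-(1 : ℝ) / 3) * (1 + P t) ^ (-(1 : ℝ) / 3 - 1))) (Icc 0 T) t := by
    intro t ht
    exact ((hPd' t ht).rpow_const (p := -(1 : ℝ) / 3) (Or.inl (h1P t).ne')).const_mul 3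
  -- lower bound for `g'`
  set φ : ℝ → ℝ := fun s => ν * (D s / (1 + P s) ^ ((4 : ℝ) / 3)) - 2 * κ * P s ^ ((1 : ℝ) / 3)
    with hφ
  have hφ_le : ∀ t ∈ Icc 0 T,
      φ t ≤ 3 * (2 * Ef t * (-(1 : ℝ) / 3) * (1 + P t) ^ (-(1 : ℝ) / 3 - 1)) := by
    intro t ht
    have hW : (1 + P t) ^ (-(1 : ℝ) / 3 - 1) = ((1 + P t) ^ ((4 : ℝ) / 3))⁻¹ := by
      rw [show (-(1 : ℝ) / 3 - 1) = -((4 : ℝ) / 3) by norm_num, Real.rpow_neg (h1P t).le]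
    rw [hW]
    have hQ : 0 < (1 + P t) ^ ((4 : ℝ) / 3) := Real.rpow_pos_of_pos (h1P t) _
    -- `P^{5/3} ≤ P^{1/3} (1+P)^{4/3}`
    have h53 : P t ^ ((5 : ℝ) / 3) ≤ P t ^ ((1 : ℝ) / 3) * (1 + P t) ^ ((4 : ℝ) / 3) := by
      rw [show ((5 : ℝ) / 3) = (1 : ℝ) / 3 + (4 : ℝ) / 3 by norm_num,
        Real.rpow_add' (hP0 t) (by norm_num)]
      exact mul_le_mul_of_nonneg_left
        (Real.rpow_le_rpow (hP0 t) (by linarith) (by norm_num)) (Real.rpow_nonneg (hP0 t) _)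
    have hr := hrate t ht
    -- multiply through by the positive weight
    rw [hφ]
    simp only
    rw [div_eq_mul_inv]
    have key : ν * D t - 2 * κ * (P t ^ ((1 : ℝ) / 3) * (1 + P t) ^ ((4 : ℝ) / 3)) ≤ -2 * Ef t := by
      nlinarith [h53, hκ0]
    have key2 : (ν * D t - 2 * κ * (P t ^ ((1 : ℝ) / 3) * (1 + P t) ^ ((4 : ℝ) / 3))) *
        ((1 + P t) ^ ((4 : ℝ) / 3))⁻¹ ≤ -2 * Ef t * ((1 + P t) ^ ((4 : ℝ) / 3))⁻¹ :=
      mul_le_mul_of_nonneg_right key (inv_nonneg.2 hQ.le)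
    have e1 : (ν * D t - 2 * κ * (P t ^ ((1 : ℝ) / 3) * (1 + P t) ^ ((4 : ℝ) / 3))) *
        ((1 + P t) ^ ((4 : ℝ) / 3))⁻¹ =
        ν * (D t * ((1 + P t) ^ ((4 : ℝ) / 3))⁻¹) - 2 * κ * P t ^ ((1 : ℝ) / 3) := by
      field_simp
    have e2 : -2 * Ef t * ((1 + P t) ^ ((4 : ℝ) / 3))⁻¹ =
        3 * (2 * Ef t * (-(1 : ℝ) / 3) * ((1 + P t) ^ ((4 : ℝ) / 3))⁻¹) := by ring
    rw [← e1, ← e2]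
    exact key2
  -- continuity and integrability
  have hPc : ContinuousOn P (Icc 0 T) := continuousOn_laplacianSq hT h
  have hDc : ContinuousOn D (Icc 0 T) := continuousOn_gradNormSq_laplacian hT h
  have h1Pc : ContinuousOn (fun s => 1 + P s) (Icc 0 T) := continuousOn_const.add hPc
  have hWc : ContinuousOn (fun s => D s / (1 + P s) ^ ((4 : ℝ) / 3)) (Icc 0 T) :=
    hDc.div (h1Pc.rpow_const fun s _ => Or.inl (h1P s).ne')
      fun s _ => (Real.rpow_pos_of_pos (h1P s) _).ne'
  have hP13c : ContinuousOn (fun s => P s ^ ((1 : ℝ) / 3)) (Icc 0 T) :=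
    hPc.rpow_const fun s _ => Or.inr (by norm_num)
  have hφc : ContinuousOn φ (Icc 0 T) :=
    (continuousOn_const.mul hWc).sub (continuousOn_const.mul hP13c)
  have hgc : ContinuousOn g (Icc 0 T) := fun t ht => (hgd t ht).continuousWithinAt
  have hgd' : ∀ t ∈ Ioo 0 T, HasDerivWithinAt g
      (3 * (2 * Ef t * (-(1 : ℝ) / 3) * (1 + P t) ^ (-(1 : ℝ) / 3 - 1))) (Ioi t) t :=
    fun t ht => ((hgd t (Ioo_subset_Icc_self ht)).hasDerivAt (Icc_mem_nhds ht.1 ht.2)).hasDerivWithinAt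
  have hmain := intervalIntegral.integral_le_sub_of_hasDeriv_right_of_le hT.le hgc hgd'
    hφc.integrableOn_Icc (fun t ht => hφ_le t (Ioo_subset_Icc_self ht))
  -- `g T - g 0 ≤ 3`
  have hgT : g T ≤ 3 := by
    have h1 : (1 + P T) ^ (-(1 : ℝ) / 3) ≤ 1 :=
      Real.rpow_le_one_of_one_le_of_nonpos (by linarith [hP0 T]) (by norm_num)
    have : g T = 3 * (1 + P T) ^ (-(1 : ℝ) / 3) := rfl
    linarith
  have hg0 : 0 ≤ g 0 := by
    have : g 0 = 3 * (1 + P 0) ^ (-(1 : ℝ) / 3) := rfl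
    rw [this]
    exact mul_nonneg (by norm_num) (Real.rpow_nonneg (h1P 0).le _)
  -- split `∫ φ`
  have hWi : IntervalIntegrable (fun s => D s / (1 + P s) ^ ((4 : ℝ) / 3)) volume 0 T :=
    (hWc.mono (by rw [uIcc_of_le hT.le])).intervalIntegrable
  have hP13i : IntervalIntegrable (fun s => P s ^ ((1 : ℝ) / 3)) volume 0 T :=
    (hP13c.mono (by rw [uIcc_of_le hT.le])).intervalIntegrable
  have hsplit : ∫ t in (0 : ℝ)..T, φ t =
      ν * (∫ t in (0 : ℝ)..T, D t / (1 + P t) ^ ((4 : ℝ) / 3)) -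
        2 * κ * ∫ t in (0 : ℝ)..T, P t ^ ((1 : ℝ) / 3) := by
    rw [hφ]
    rw [intervalIntegral.integral_sub (hWi.const_mul ν) (hP13i.const_mul (2 * κ)),
      intervalIntegral.integral_const_mul, intervalIntegral.integral_const_mul]
  -- the `H²` rung
  have hA : ∫ t in (0 : ℝ)..T, P t ^ ((1 : ℝ) / 3) ≤
      (1 / ν + 27 * (∫ x, ‖u 0 x‖ ^ 2) / (8 * π ^ 4 * ν ^ 5)) ^ ((1 : ℝ) / 3) *
        (T + (∫ x, ‖u 0 x‖ ^ 2) / (2 * ν)) ^ ((2 : ℝ) / 3) :=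
    Torus.classicalNS_integral_laplacian_twoThirds_le hd hν hT h hmean
  have h2κ : 2 * κ = 3 / 2 * (3 * Real.sqrt 2 / π) ^ ((4 : ℝ) / 3) * (2 * ν) ^ (-(1 : ℝ) / 3) := by
    rw [hκ, hc]; ring
  rw [hsplit] at hmain
  rw [← h2κ]
  have h2κ0 : 0 ≤ 2 * κ := by positivity
  nlinarith [hmain, hgT, hg0, mul_le_mul_of_nonneg_left hA h2κ0]

/-! ### The square `(3, 1)`: `∫₀ᵀ ‖∇Δu‖₂^{2/5} dt` -/

/-- **`∫₀ᵀ ‖u‖_{Ḣ³}^{2/5} dt` bounded a priori, explicit** (Foias–Guillopé–Temam 1981, Thm 3.1,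
`m = 3`: `∫₀ᵀ‖u‖_{H^m}^{2/(2m−1)} < ∞`; Gibbon's square `(3,1)`, `α_{3,1} = 2/5`), classical
solutions with mean-zero slices on `[0, T] × T^d`, `card d = 3`: with `B₂ = Y₁^{1/3}(T+E)^{2/3}`,
`W₃ = 3 + (3/2)(3√2/π)^{4/3}(2ν)^{−1/3}B₂`,
`∫₀ᵀ (‖∇Δu(t)‖₂²)^{1/5} dt ≤ (W₃/ν)^{1/5} (T + B₂)^{4/5}` (Hölder `5, 5/4` on
`‖∇Δu‖₂^{2/5} = [‖∇Δu‖₂²/(1+‖Δu‖₂²)^{4/3}]^{1/5}(1+‖Δu‖₂²)^{4/15}`, `(1+P)^{1/3} ≤ 1 + P^{1/3}`).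
[cite: FoiasGuillopeTemam1981, Thm 3.1 (m = 3)] [cite: Gibbon2019Chessboard, Thm 1, Table 1 (square (3,1))] -/
theorem Torus.classicalNS_integral_gradNormSq_laplacian_fifth_le (hd : Fintype.card d = 3)
    {ν T : ℝ} (hν : 0 < ν) (hT : 0 < T) {u : ℝ → UnitAddTorus d → EuclideanSpace ℝ d}
    {p : ℝ → UnitAddTorus d → ℝ} (h : Torus.IsClassicalNSSolutionOn (Icc 0 T) ν 0 u p)
    (hmean : ∀ t ∈ Icc 0 T, Torus.HasZeroMean (u t)) :
    ∫ t in (0 : ℝ)..T, Torus.gradNormSq (Torus.laplacian (u t)) ^ ((1 : ℝ) / 5) ≤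
      ((3 + 3 / 2 * (3 * Real.sqrt 2 / π) ^ ((4 : ℝ) / 3) * (2 * ν) ^ (-(1 : ℝ) / 3) *
          ((1 / ν + 27 * (∫ x, ‖u 0 x‖ ^ 2) / (8 * π ^ 4 * ν ^ 5)) ^ ((1 : ℝ) / 3) *
            (T + (∫ x, ‖u 0 x‖ ^ 2) / (2 * ν)) ^ ((2 : ℝ) / 3))) / ν) ^ ((1 : ℝ) / 5) *
        (T + (1 / ν + 27 * (∫ x, ‖u 0 x‖ ^ 2) / (8 * π ^ 4 * ν ^ 5)) ^ ((1 : ℝ) / 3) *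
            (T + (∫ x, ‖u 0 x‖ ^ 2) / (2 * ν)) ^ ((2 : ℝ) / 3)) ^ ((4 : ℝ) / 5) := by
  have hπ : 0 < π := Real.pi_pos
  set B₂ : ℝ := (1 / ν + 27 * (∫ x, ‖u 0 x‖ ^ 2) / (8 * π ^ 4 * ν ^ 5)) ^ ((1 : ℝ) / 3) *
    (T + (∫ x, ‖u 0 x‖ ^ 2) / (2 * ν)) ^ ((2 : ℝ) / 3) with hB₂
  set W : ℝ := 3 + 3 / 2 * (3 * Real.sqrt 2 / π) ^ ((4 : ℝ) / 3) * (2 * ν) ^ (-(1 : ℝ) / 3) * B₂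
    with hW
  have hu0 : 0 ≤ ∫ x, ‖u 0 x‖ ^ 2 := integral_nonneg fun x => sq_nonneg _
  have hB0 : 0 ≤ B₂ := by positivity
  have hW0 : 0 ≤ W := by positivity
  set P : ℝ → ℝ := fun s => ∫ x, ‖Torus.laplacian (u s) x‖ ^ 2 with hPdef
  set D : ℝ → ℝ := fun s => Torus.gradNormSq (Torus.laplacian (u s)) with hDdef
  have hP0 : ∀ s, 0 ≤ P s := fun s => integral_nonneg fun x => sq_nonneg _
  have hD0 : ∀ s, 0 ≤ D s := fun s => Torus.gradNormSq_nonneg _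
  have h1P : ∀ s, 0 < 1 + P s := fun s => by have := hP0 s; positivity
  set w : ℝ → ℝ := fun s => D s / (1 + P s) ^ ((4 : ℝ) / 3) with hw
  have hw0 : ∀ s, 0 ≤ w s := fun s => div_nonneg (hD0 s) (Real.rpow_nonneg (h1P s).le _)
  set a : ℝ → ℝ := fun s => w s ^ ((1 : ℝ) / 5) with ha
  set b : ℝ → ℝ := fun s => (1 + P s) ^ ((4 : ℝ) / 15) with hb
  have ha0 : ∀ s, 0 ≤ a s := fun s => Real.rpow_nonneg (hw0 s) _
  have hb0 : ∀ s, 0 ≤ b s := fun s => Real.rpow_nonneg (h1P s).le _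
  -- pointwise `D^{1/5} = a b`
  have hpt : ∀ s, D s ^ ((1 : ℝ) / 5) = a s * b s := by
    intro s
    have hQ : 0 < (1 + P s) ^ ((4 : ℝ) / 3) := Real.rpow_pos_of_pos (h1P s) _
    have e : D s = w s * (1 + P s) ^ ((4 : ℝ) / 3) := by
      rw [hw]; simp only; rw [div_mul_cancel₀ _ hQ.ne']
    rw [e, Real.mul_rpow (hw0 s) hQ.le, ← Real.rpow_mul (h1P s).le, ha, hb]
    norm_num
  -- continuity
  have hPc : ContinuousOn P (Icc 0 T) := continuousOn_laplacianSq hT h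
  have hDc : ContinuousOn D (Icc 0 T) := continuousOn_gradNormSq_laplacian hT h
  have h1Pc : ContinuousOn (fun s => 1 + P s) (Icc 0 T) := continuousOn_const.add hPc
  have hwc : ContinuousOn w (Icc 0 T) :=
    hDc.div (h1Pc.rpow_const fun s _ => Or.inl (h1P s).ne')
      fun s _ => (Real.rpow_pos_of_pos (h1P s) _).ne'
  have hac : ContinuousOn a (Icc 0 T) := hwc.rpow_const fun s _ => Or.inr (by norm_num)
  have hbc : ContinuousOn b (Icc 0 T) := h1Pc.rpow_const fun s _ => Or.inl (h1P s).ne'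
  -- Hölder `5, 5/4`
  set μ : Measure ℝ := volume.restrict (Ioc 0 T) with hμ
  haveI : IsFiniteMeasure μ := by rw [hμ]; infer_instance
  have hpq : (5 : ℝ).HolderConjugate (5 / 4) := Real.holderConjugate_iff.2 ⟨by norm_num, by norm_num⟩
  have hmemLp : ∀ {g : ℝ → ℝ}, ContinuousOn g (Icc 0 T) → ∀ r : ℝ≥0∞, MemLp g r μ := by
    intro g hg r
    obtain ⟨C, hC⟩ := isCompact_Icc.exists_bound_of_continuousOn hg
    have hmeas : AEStronglyMeasurable g μ :=
      (hg.mono Ioc_subset_Icc_self).aestronglyMeasurable measurableSet_Ioc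
    refine MemLp.of_bound hmeas C ?_
    rw [hμ, ae_restrict_iff' measurableSet_Ioc]
    exact ae_of_all _ fun s hs => hC s (Ioc_subset_Icc_self hs)
  have hH := integral_mul_le_Lp_mul_Lq_of_nonneg (μ := μ) hpq
    (ae_of_all _ fun s => ha0 s) (ae_of_all _ fun s => hb0 s) (hmemLp hac _) (hmemLp hbc _)
  have ha5 : ∀ s, a s ^ (5 : ℝ) = w s := fun s => by
    rw [ha]; simp only; rw [← Real.rpow_mul (hw0 s)]; norm_num
  have hb54 : ∀ s, b s ^ ((5 : ℝ) / 4) = (1 + P s) ^ ((1 : ℝ) / 3) := fun s => by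
    rw [hb]; simp only; rw [← Real.rpow_mul (h1P s).le]; norm_num
  have hI2 : ∫ s, a s ^ (5 : ℝ) ∂μ = ∫ t in (0 : ℝ)..T, w t := by
    rw [intervalIntegral.integral_of_le hT.le, hμ]
    exact integral_congr_ae (ae_of_all _ fun s => ha5 s)
  have hI3 : ∫ s, b s ^ ((5 : ℝ) / 4) ∂μ = ∫ t in (0 : ℝ)..T, (1 + P t) ^ ((1 : ℝ) / 3) := by
    rw [intervalIntegral.integral_of_le hT.le, hμ]
    exact integral_congr_ae (ae_of_all _ fun s => hb54 s)
  rw [hI2, hI3] at hH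
  -- the two inputs
  have hA : ∫ t in (0 : ℝ)..T, w t ≤ W / ν := by
    rw [le_div_iff₀ hν, mul_comm]
    have := Torus.classicalNS_integral_gradNormSq_laplacian_div_le hd hν hT h hmean
    simpa [hW, hB₂] using this
  have hB : ∫ t in (0 : ℝ)..T, (1 + P t) ^ ((1 : ℝ) / 3) ≤ T + B₂ := by
    have h13 : ∀ t, (1 + P t) ^ ((1 : ℝ) / 3) ≤ 1 + P t ^ ((1 : ℝ) / 3) := fun t => by
      have := Real.rpow_add_le_add_rpow zero_le_one (hP0 t) (by norm_num : (0 : ℝ) ≤ 1 / 3)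
        (by norm_num)
      simpa using this
    have hP13c : ContinuousOn (fun s => P s ^ ((1 : ℝ) / 3)) (Icc 0 T) :=
      hPc.rpow_const fun s _ => Or.inr (by norm_num)
    have hP13i : IntervalIntegrable (fun s => P s ^ ((1 : ℝ) / 3)) volume 0 T :=
      (hP13c.mono (by rw [uIcc_of_le hT.le])).intervalIntegrable
    have hmono : ∫ t in (0 : ℝ)..T, (1 + P t) ^ ((1 : ℝ) / 3) ≤
        ∫ t in (0 : ℝ)..T, (1 + P t ^ ((1 : ℝ) / 3)) := by
      refine intervalIntegral.integral_mono_on hT.le ?_ (intervalIntegrable_const.add hP13i)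
        fun t _ => h13 t
      exact ((h1Pc.rpow_const fun s _ => Or.inl (h1P s).ne').mono
        (by rw [uIcc_of_le hT.le])).intervalIntegrable
    rw [intervalIntegral.integral_add intervalIntegrable_const hP13i, intervalIntegral.integral_const,
      smul_eq_mul, sub_zero, mul_one] at hmono
    have hE := Torus.classicalNS_integral_laplacian_twoThirds_le hd hν hT h hmean
    rw [← hB₂] at hE
    linarith
  have hA0 : 0 ≤ ∫ t in (0 : ℝ)..T, w t := intervalIntegral.integral_nonneg hT.le fun s _ => hw0 s
  have hB0' : 0 ≤ ∫ t in (0 : ℝ)..T, (1 + P t) ^ ((1 : ℝ) / 3) :=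
    intervalIntegral.integral_nonneg hT.le fun s _ => Real.rpow_nonneg (h1P s).le _
  -- assemble
  have hL : ∫ t in (0 : ℝ)..T, D t ^ ((1 : ℝ) / 5) = ∫ s, a s * b s ∂μ := by
    rw [intervalIntegral.integral_of_le hT.le, hμ]
    exact integral_congr_ae (ae_of_all _ fun s => hpt s)
  rw [hL]
  refine hH.trans ?_
  rw [show (1 / (5 / 4 : ℝ)) = (4 : ℝ) / 5 by norm_num]
  exact mul_le_mul (Real.rpow_le_rpow hA0 hA (by norm_num))
    (Real.rpow_le_rpow hB0' hB (by norm_num)) (Real.rpow_nonneg hB0' _)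
    (Real.rpow_nonneg (hA0.trans hA) _)

/-! ### The square `(1, ∞)`: `∫₀ᵀ ‖∇u‖_∞^{1/2} dt` through the explicit Agmon majorant -/

/-- **`∫₀ᵀ ‖∇u‖_∞^{1/2} dt` bounded a priori, majorant form, explicit** (Foias–Guillopé–Temam
1981, Thm 3.1: "in particular `∫₀ᵀ ‖∇u‖_{L^∞}^{1/2} dt < ∞`"; Gibbon's square `(1, ∞)`,
`α_{1,∞} = 1/2`). Along a classical solution of the unforced Navier–Stokes equations with `ν > 0`
on `[0, T] × T^d`, `card d = 3`, `T > 0`, with mean-zero velocity slices, the explicit pointwise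
majorant `A(t)² := (2/π²)‖Δu(t)‖₂‖∇Δu(t)‖₂ ≥ ∑ᵢ‖∂ᵢu(t,x)‖²` (gradient Agmon inequality
`Torus.sum_norm_sq_partialDeriv_le_agmon_explicit`; hence also `≥ ½|ω(t,x)|²`) satisfies, with
`B₂ = Y₁^{1/3}(T+E)^{2/3}`, `W₃ = 3 + (3/2)(3√2/π)^{4/3}(2ν)^{−1/3}B₂`,
`∫₀ᵀ A(t)^{1/2} dt = ∫₀ᵀ ((2/π²)‖Δu‖₂‖∇Δu‖₂)^{1/4} dt ≤ (2/π²)^{1/4} (W₃/ν)^{1/8} (T + B₂)^{7/8}`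
(Hölder `8, 8/7` on `‖Δu‖₂^{1/4}‖∇Δu‖₂^{1/4} ≤ [‖∇Δu‖₂²/(1+‖Δu‖₂²)^{4/3}]^{1/8}(1+‖Δu‖₂²)^{7/24}`).
Contrast: the Beale–Kato–Majda continuation criterion (`Torus.classicalNS_bkm_continuation`)
needs `∫₀ᵀ‖ω‖_∞ dt`, exponent `1 = 2·α_{1,∞}`.
[cite: FoiasGuillopeTemam1981, Thm 3.1 (∫‖∇u‖_∞^{1/2} < ∞)] [cite: Gibbon2019Chessboard, Thm 1, Table 1 (square (1,∞))] -/
theorem Torus.classicalNS_integral_gradientAgmonMajorant_le (hd : Fintype.card d = 3)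
    {ν T : ℝ} (hν : 0 < ν) (hT : 0 < T) {u : ℝ → UnitAddTorus d → EuclideanSpace ℝ d}
    {p : ℝ → UnitAddTorus d → ℝ} (h : Torus.IsClassicalNSSolutionOn (Icc 0 T) ν 0 u p)
    (hmean : ∀ t ∈ Icc 0 T, Torus.HasZeroMean (u t)) :
    ∫ t in (0 : ℝ)..T, (2 / π ^ 2 * Real.sqrt (∫ x, ‖Torus.laplacian (u t) x‖ ^ 2) *
        Real.sqrt (Torus.gradNormSq (Torus.laplacian (u t)))) ^ ((1 : ℝ) / 4) ≤
      (2 / π ^ 2) ^ ((1 : ℝ) / 4) *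
        (((3 + 3 / 2 * (3 * Real.sqrt 2 / π) ^ ((4 : ℝ) / 3) * (2 * ν) ^ (-(1 : ℝ) / 3) *
            ((1 / ν + 27 * (∫ x, ‖u 0 x‖ ^ 2) / (8 * π ^ 4 * ν ^ 5)) ^ ((1 : ℝ) / 3) *
              (T + (∫ x, ‖u 0 x‖ ^ 2) / (2 * ν)) ^ ((2 : ℝ) / 3))) / ν) ^ ((1 : ℝ) / 8) *
          (T + (1 / ν + 27 * (∫ x, ‖u 0 x‖ ^ 2) / (8 * π ^ 4 * ν ^ 5)) ^ ((1 : ℝ) / 3) *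
              (T + (∫ x, ‖u 0 x‖ ^ 2) / (2 * ν)) ^ ((2 : ℝ) / 3)) ^ ((7 : ℝ) / 8)) := by
  have hπ : 0 < π := Real.pi_pos
  have hc0 : (0 : ℝ) ≤ 2 / π ^ 2 := by positivity
  set B₂ : ℝ := (1 / ν + 27 * (∫ x, ‖u 0 x‖ ^ 2) / (8 * π ^ 4 * ν ^ 5)) ^ ((1 : ℝ) / 3) *
    (T + (∫ x, ‖u 0 x‖ ^ 2) / (2 * ν)) ^ ((2 : ℝ) / 3) with hB₂
  set W : ℝ := 3 + 3 / 2 * (3 * Real.sqrt 2 / π) ^ ((4 : ℝ) / 3) * (2 * ν) ^ (-(1 : ℝ) / 3) * B₂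
    with hW
  have hu0 : 0 ≤ ∫ x, ‖u 0 x‖ ^ 2 := integral_nonneg fun x => sq_nonneg _
  have hB0 : 0 ≤ B₂ := by positivity
  have hW0 : 0 ≤ W := by positivity
  set P : ℝ → ℝ := fun s => ∫ x, ‖Torus.laplacian (u s) x‖ ^ 2 with hPdef
  set D : ℝ → ℝ := fun s => Torus.gradNormSq (Torus.laplacian (u s)) with hDdef
  have hP0 : ∀ s, 0 ≤ P s := fun s => integral_nonneg fun x => sq_nonneg _
  have hD0 : ∀ s, 0 ≤ D s := fun s => Torus.gradNormSq_nonneg _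
  have h1P : ∀ s, 0 < 1 + P s := fun s => by have := hP0 s; positivity
  set w : ℝ → ℝ := fun s => D s / (1 + P s) ^ ((4 : ℝ) / 3) with hw
  have hw0 : ∀ s, 0 ≤ w s := fun s => div_nonneg (hD0 s) (Real.rpow_nonneg (h1P s).le _)
  set a : ℝ → ℝ := fun s => w s ^ ((1 : ℝ) / 8) with ha
  set b : ℝ → ℝ := fun s => (1 + P s) ^ ((7 : ℝ) / 24) with hb
  have ha0 : ∀ s, 0 ≤ a s := fun s => Real.rpow_nonneg (hw0 s) _
  have hb0 : ∀ s, 0 ≤ b s := fun s => Real.rpow_nonneg (h1P s).le _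
  -- the integrand and its pointwise bound `L ≤ (2/π²)^{1/4} a b`
  set L : ℝ → ℝ := fun s => (2 / π ^ 2 * Real.sqrt (P s) * Real.sqrt (D s)) ^ ((1 : ℝ) / 4)
    with hL
  have hpt : ∀ s, L s ≤ (2 / π ^ 2) ^ ((1 : ℝ) / 4) * (a s * b s) := by
    intro s
    have hQ : 0 < (1 + P s) ^ ((4 : ℝ) / 3) := Real.rpow_pos_of_pos (h1P s) _
    -- `L = (2/π²)^{1/4} P^{1/8} D^{1/8}`
    have eL : L s = (2 / π ^ 2) ^ ((1 : ℝ) / 4) * (P s ^ ((1 : ℝ) / 8) * D s ^ ((1 : ℝ) / 8)) := by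
      rw [hL]
      simp only
      rw [Real.mul_rpow (by positivity) (Real.sqrt_nonneg _),
        Real.mul_rpow hc0 (Real.sqrt_nonneg _), Real.sqrt_eq_rpow, Real.sqrt_eq_rpow,
        ← Real.rpow_mul (hP0 s), ← Real.rpow_mul (hD0 s)]
      norm_num
      ring
    -- `D^{1/8} = a (1+P)^{1/6}`, `P^{1/8} ≤ (1+P)^{1/8}`
    have eD : D s ^ ((1 : ℝ) / 8) = a s * (1 + P s) ^ ((1 : ℝ) / 6) := by
      have e : D s = w s * (1 + P s) ^ ((4 : ℝ) / 3) := by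
        rw [hw]; simp only; rw [div_mul_cancel₀ _ hQ.ne']
      rw [e, Real.mul_rpow (hw0 s) hQ.le, ← Real.rpow_mul (h1P s).le, ha]
      norm_num
    have hP8 : P s ^ ((1 : ℝ) / 8) ≤ (1 + P s) ^ ((1 : ℝ) / 8) :=
      Real.rpow_le_rpow (hP0 s) (by linarith) (by norm_num)
    have eb : (1 + P s) ^ ((1 : ℝ) / 8) * (1 + P s) ^ ((1 : ℝ) / 6) = b s := by
      rw [← Real.rpow_add (h1P s), hb]
      norm_num
    rw [eL]
    refine mul_le_mul_of_nonneg_left ?_ (Real.rpow_nonneg hc0 _)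
    calc P s ^ ((1 : ℝ) / 8) * D s ^ ((1 : ℝ) / 8)
        ≤ (1 + P s) ^ ((1 : ℝ) / 8) * D s ^ ((1 : ℝ) / 8) :=
          mul_le_mul_of_nonneg_right hP8 (Real.rpow_nonneg (hD0 s) _)
      _ = a s * ((1 + P s) ^ ((1 : ℝ) / 8) * (1 + P s) ^ ((1 : ℝ) / 6)) := by rw [eD]; ring
      _ = a s * b s := by rw [eb]
  -- continuity
  have hPc : ContinuousOn P (Icc 0 T) := continuousOn_laplacianSq hT h
  have hDc : ContinuousOn D (Icc 0 T) := continuousOn_gradNormSq_laplacian hT h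
  have h1Pc : ContinuousOn (fun s => 1 + P s) (Icc 0 T) := continuousOn_const.add hPc
  have hwc : ContinuousOn w (Icc 0 T) :=
    hDc.div (h1Pc.rpow_const fun s _ => Or.inl (h1P s).ne')
      fun s _ => (Real.rpow_pos_of_pos (h1P s) _).ne'
  have hac : ContinuousOn a (Icc 0 T) := hwc.rpow_const fun s _ => Or.inr (by norm_num)
  have hbc : ContinuousOn b (Icc 0 T) := h1Pc.rpow_const fun s _ => Or.inl (h1P s).ne'
  have hLc : ContinuousOn L (Icc 0 T) :=
    ((continuousOn_const.mul (Real.continuous_sqrt.comp_continuousOn hPc)).mul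
      (Real.continuous_sqrt.comp_continuousOn hDc)).rpow_const fun s _ => Or.inr (by norm_num)
  -- Hölder `8, 8/7`
  set μ : Measure ℝ := volume.restrict (Ioc 0 T) with hμ
  haveI : IsFiniteMeasure μ := by rw [hμ]; infer_instance
  have hpq : (8 : ℝ).HolderConjugate (8 / 7) := Real.holderConjugate_iff.2 ⟨by norm_num, by norm_num⟩
  have hmemLp : ∀ {g : ℝ → ℝ}, ContinuousOn g (Icc 0 T) → ∀ r : ℝ≥0∞, MemLp g r μ := by
    intro g hg r
    obtain ⟨C, hC⟩ := isCompact_Icc.exists_bound_of_continuousOn hg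
    have hmeas : AEStronglyMeasurable g μ :=
      (hg.mono Ioc_subset_Icc_self).aestronglyMeasurable measurableSet_Ioc
    refine MemLp.of_bound hmeas C ?_
    rw [hμ, ae_restrict_iff' measurableSet_Ioc]
    exact ae_of_all _ fun s hs => hC s (Ioc_subset_Icc_self hs)
  have hH := integral_mul_le_Lp_mul_Lq_of_nonneg (μ := μ) hpq
    (ae_of_all _ fun s => ha0 s) (ae_of_all _ fun s => hb0 s) (hmemLp hac _) (hmemLp hbc _)
  have ha8 : ∀ s, a s ^ (8 : ℝ) = w s := fun s => by
    rw [ha]; simp only; rw [← Real.rpow_mul (hw0 s)]; norm_num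
  have hb87 : ∀ s, b s ^ ((8 : ℝ) / 7) = (1 + P s) ^ ((1 : ℝ) / 3) := fun s => by
    rw [hb]; simp only; rw [← Real.rpow_mul (h1P s).le]; norm_num
  have hI2 : ∫ s, a s ^ (8 : ℝ) ∂μ = ∫ t in (0 : ℝ)..T, w t := by
    rw [intervalIntegral.integral_of_le hT.le, hμ]
    exact integral_congr_ae (ae_of_all _ fun s => ha8 s)
  have hI3 : ∫ s, b s ^ ((8 : ℝ) / 7) ∂μ = ∫ t in (0 : ℝ)..T, (1 + P t) ^ ((1 : ℝ) / 3) := by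
    rw [intervalIntegral.integral_of_le hT.le, hμ]
    exact integral_congr_ae (ae_of_all _ fun s => hb87 s)
  rw [hI2, hI3] at hH
  -- the two inputs
  have hA : ∫ t in (0 : ℝ)..T, w t ≤ W / ν := by
    rw [le_div_iff₀ hν, mul_comm]
    have := Torus.classicalNS_integral_gradNormSq_laplacian_div_le hd hν hT h hmean
    simpa [hW, hB₂] using this
  have hB : ∫ t in (0 : ℝ)..T, (1 + P t) ^ ((1 : ℝ) / 3) ≤ T + B₂ := by
    have h13 : ∀ t, (1 + P t) ^ ((1 : ℝ) / 3) ≤ 1 + P t ^ ((1 : ℝ) / 3) := fun t => by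
      have := Real.rpow_add_le_add_rpow zero_le_one (hP0 t) (by norm_num : (0 : ℝ) ≤ 1 / 3)
        (by norm_num)
      simpa using this
    have hP13c : ContinuousOn (fun s => P s ^ ((1 : ℝ) / 3)) (Icc 0 T) :=
      hPc.rpow_const fun s _ => Or.inr (by norm_num)
    have hP13i : IntervalIntegrable (fun s => P s ^ ((1 : ℝ) / 3)) volume 0 T :=
      (hP13c.mono (by rw [uIcc_of_le hT.le])).intervalIntegrable
    have hmono : ∫ t in (0 : ℝ)..T, (1 + P t) ^ ((1 : ℝ) / 3) ≤
        ∫ t in (0 : ℝ)..T, (1 + P t ^ ((1 : ℝ) / 3)) := by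
      refine intervalIntegral.integral_mono_on hT.le ?_ (intervalIntegrable_const.add hP13i)
        fun t _ => h13 t
      exact ((h1Pc.rpow_const fun s _ => Or.inl (h1P s).ne').mono
        (by rw [uIcc_of_le hT.le])).intervalIntegrable
    rw [intervalIntegral.integral_add intervalIntegrable_const hP13i, intervalIntegral.integral_const,
      smul_eq_mul, sub_zero, mul_one] at hmono
    have hE := Torus.classicalNS_integral_laplacian_twoThirds_le hd hν hT h hmean
    rw [← hB₂] at hE
    linarith
  have hA0 : 0 ≤ ∫ t in (0 : ℝ)..T, w t := intervalIntegral.integral_nonneg hT.le fun s _ => hw0 s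
  have hB0' : 0 ≤ ∫ t in (0 : ℝ)..T, (1 + P t) ^ ((1 : ℝ) / 3) :=
    intervalIntegral.integral_nonneg hT.le fun s _ => Real.rpow_nonneg (h1P s).le _
  -- assemble
  have hmono : ∫ t in (0 : ℝ)..T, L t ≤ ∫ t in (0 : ℝ)..T, (2 / π ^ 2) ^ ((1 : ℝ) / 4) * (a t * b t) := by
    refine intervalIntegral.integral_mono_on hT.le ?_ ?_ fun s _ => hpt s
    · exact (hLc.mono (by rw [uIcc_of_le hT.le])).intervalIntegrable
    · exact ((continuousOn_const.mul (hac.mul hbc)).mono (by rw [uIcc_of_le hT.le])).intervalIntegrable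
  have hI1 : ∫ t in (0 : ℝ)..T, (2 / π ^ 2) ^ ((1 : ℝ) / 4) * (a t * b t) =
      (2 / π ^ 2) ^ ((1 : ℝ) / 4) * ∫ s, a s * b s ∂μ := by
    rw [intervalIntegral.integral_const_mul, intervalIntegral.integral_of_le hT.le, hμ]
  have hH' : ∫ s, a s * b s ∂μ ≤ (W / ν) ^ ((1 : ℝ) / 8) * (T + B₂) ^ ((7 : ℝ) / 8) := by
    refine hH.trans ?_
    rw [show (1 / (8 / 7 : ℝ)) = (7 : ℝ) / 8 by norm_num]
    exact mul_le_mul (Real.rpow_le_rpow hA0 hA (by norm_num))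
      (Real.rpow_le_rpow hB0' hB (by norm_num)) (Real.rpow_nonneg hB0' _)
      (Real.rpow_nonneg (hA0.trans hA) _)
  calc ∫ t in (0 : ℝ)..T, L t ≤ (2 / π ^ 2) ^ ((1 : ℝ) / 4) * ∫ s, a s * b s ∂μ :=
        hmono.trans (le_of_eq hI1)
    _ ≤ (2 / π ^ 2) ^ ((1 : ℝ) / 4) * ((W / ν) ^ ((1 : ℝ) / 8) * (T + B₂) ^ ((7 : ℝ) / 8)) :=
        mul_le_mul_of_nonneg_left hH' (Real.rpow_nonneg hc0 _)

end Literature.Analysis.FluidPDE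

end
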